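import Literature.NumberTheory.EllipticCurves.MultiplicativeReductionInertiaShapeProofs
import Literature.NumberTheory.EllipticCurves.OrdinaryReductionPeuRamifieProofs
import Literature.NumberTheory.EllipticCurves.TateFormLevelAdditionProofs
import Literature.NumberTheory.EllipticCurves.KernelReductionTateFormDoublingProofs
import Literature.NumberTheory.EllipticCurves.MultiplicativeUnramifiedTorsionProofs
import HarnessLib

/-!
# Multiplicative reduction at `v ∣ p` with `p ∣ ord_v Δ_min`: `ρ̄_{E,p}|Γ_{K_v}` is peu ramifié
# (Serre 1987, §2.9 Prop. 5 / (4.1.12))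

`Proofs` file (theorems only: no definition, no named fact), topic `NumberTheory/EllipticCurves`;
the multiplicative companion of `OrdinaryReductionPeuRamifieProofs` (good ordinary `v ∣ p`).

* `WeierstrassCurve.isPeuRamifie_restrictField_of_hasMultiplicativeReductionAt_of_dvd` — for an
  elliptic curve `E` over a number field `K`, an odd prime `p`, a place `v ∣ p` of MULTIPLICATIVE
  reduction with `e(v ∣ p) = 1` (`p` a uniformiser of `𝓞_v`) and `p ∣ ord_v(Δ_min)`, a framing
  `ρ̄` of `E[p]` and `j : 𝔽_p → k` into a discrete field: `(ρ̄ ⊗_j k)|Γ_{K_v}` is peu ramifiée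
  (`ModPGaloisRep.IsPeuRamifie`: `ρ̄(I_{K_v}^u) = 1` for `u > 1`).

Serre (*Duke* 54, §2.9, p. 191; (4.1.12)) reads this off the Tate curve: `E ≅ E_q` over `K_v^nr`,
`E[p] ≅ ⟨ζ_p, q^{1/p}⟩`, and `K_v^nr(ζ_p, q^{1/p})` is peu ramifiée iff `p ∣ v(q) = ord_v Δ_min`.
The tree has no Tate uniformisation; the proof here is the elementary one through the criterion
`ModPGaloisRep.isPeuRamifie_of_forall_exists_algNorm_le` (`PeuRamifieCriterionProofs`: small image
`#ρ̄(I) ≤ p(p-1)` and, for every `τ ∈ I` acting non-trivially, an integer `ξ` of `K̄_v` fixed by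
`ker ρ̄|Γ_{K_v}` with `|p| ≤ |τξ - ξ|^{p-1}`), on the Tate form `T` of invariant `j(E)` over
`K̄_v` (`|a₆(T)| = |j|⁻¹ = |Δ_min| = |p|ⁿ`, `n = ord_v Δ_min`), to which `E(K̄)` is transported
by an inertia-equivariant isomorphism `Ψ` (`MultiplicativeReductionInertiaShapeProofs`):

* the line `X = Ψ⁻¹(T₁ ∪ O) ≤ E[p]` of order `≤ p` receives `τP - P` for `τ ∈ I_{K_v}`
  (loc. cit.), whence the triangular form and `#ρ̄(I) ≤ p(p-1)`
  (`IsTorsionGaloisRep.exists_conj_eq_of_line`); the points of `E[p] ∖ X` map to SMALL points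
  of `T` (`|x| < 1`: `TateForm.valuation_lt_one_of_zsmul_eq_zero`);
* the TOP small point `P = Ψb = (x_P, y_P)` of `Ψ(E[p])` has level
  `|x_P| = |a₆|^{1/p} = |p|^{n/p} ∈ |K_vˣ|` (`TateForm.pow_addOrderOf_eq_of_top`; this is where
  `p ∣ n` enters), and may be taken moved by `τ` (if `τ` fixes `b` it moves some `a ∈ X` — else it
  fixes `X ⊕ ⟨b⟩ = E[p]` — and `b + a` is again a top small point,
  `|x(P + Ψa)| = |x_P|`); then `ξ = x_P / p^{n/p}` is a unit fixed by `ker ρ̄|Γ_{K_v}` (which fixes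
  `E[p]`, and `x`-coordinates are blind to the sign of the quadratic twist in `Ψ`), with
  `τ x_P = x(P + D)`, `D = Ψ(τb - b) ∈ T₁ ∖ O`, `|x(P + D) - x_P| = |x_P| |z(D)|`
  (`TateForm.sub_X_of_branch₀_of_one_lt`) and `|z(D)|^{p-1} ≥ |p|` (the Newton polygon of `ψ_p`,
  `sq_mul_pow_le_one_of_eval_preΨ'_eq_zero`): so `|τξ - ξ|^{p-1} = |z(D)|^{p-1} ≥ |p|`.

## References

* [Serre1987] J.-P. Serre, Duke Math. J. 54 (1987), §2.9 Prop. 5 (p. 191), §2.4, (4.1.12).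
* [SerreInventiones1972] J.-P. Serre, Invent. Math. 15 (1972), §1.12.
* [SilvermanATAEC1994] J. H. Silverman, *Advanced Topics*, V.3–V.5.
* [SilvermanAEC2009] J. H. Silverman, *The Arithmetic of Elliptic Curves*, IV.6.1, VII.2.2.
-/

noncomputable section

open scoped Classical NNReal NumberField Pointwise
open NumberField IsDedekindDomain Field

namespace Literature.NumberTheory.EllipticCurves

namespace TateForm

open _root_.WeierstrassCurve

variable {L : Type*} [Field L] {w : Valuation L ℝ≥0} {T : WeierstrassCurve L}

/-- **`|p| ≤ |z(D)|^{p-1}` for a `p`-torsion point `D ≠ O` of the kernel of reduction of a Tate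
form** (`p` odd, `p ≠ 0` in `L`): `x(D)` is a root of `ψ_p = p x^{(p²-1)/2} + ⋯`, whose Newton
polygon gives `|p|² |x(D)|^{p-1} ≤ 1` (`sq_mul_pow_le_one_of_eval_preΨ'_eq_zero`), and
`|x(D)| |z(D)|² = 1`.
[cite: SilvermanAEC2009, Cor. IV.4.4, Thm. IV.6.1] [cite: Serre1987, §2.8–§2.9] -/
theorem valuation_natCast_le_pow_of_one_lt (hT : IsTateForm w T) {p : ℕ} [hp : Fact p.Prime]
    (hp2 : p ≠ 2) (hpL : (p : L) ≠ 0) {xd yd : L} {hd : T.toAffine.Nonsingular xd yd}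
    (hxd : 1 < w xd) (hpD : (p : ℤ) • (Affine.Point.some xd yd hd : T.toAffine.Point) = 0) :
    w (p : L) ≤ w (-xd / yd) ^ (p - 1) := by
  haveI := hT.isIntegral
  -- the `𝒪_w`-model
  set O := w.valuationSubring with hO
  have hvO : w.Integers O := Valuation.valuationSubring.integers w
  have hmem : ∀ {a : L}, w a ≤ 1 → a ∈ O := fun h ↦ (Valuation.mem_valuationSubring_iff w _).mpr h
  set MO : WeierstrassCurve O := ⟨⟨T.a₁, hmem (by rw [hT.a₁, map_one])⟩,
    ⟨T.a₂, hmem (by rw [hT.a₂, map_zero]; exact zero_le_one)⟩,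
    ⟨T.a₃, hmem (by rw [hT.a₃, map_zero]; exact zero_le_one)⟩,
    ⟨T.a₄, hmem (hT.w_a₄_le.trans hT.w_a₆_lt.le)⟩, ⟨T.a₆, hmem hT.w_a₆_lt.le⟩⟩ with hMO
  have hMOT : MO.baseChange L = T := rfl
  -- `ψ_p(x_D) = 0`
  have hodd : ¬ Even p := Nat.not_even_iff_odd.mpr (hp.out.odd_of_ne_two hp2)
  have hΨ : (T.ΨSq p).eval xd = 0 := (T.zsmul_some_eq_zero_iff_eval_ΨSq hd p).mp hpD
  have hroot : ((MO.baseChange L).preΨ' p).eval xd = 0 := by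
    rw [hMOT]
    rw [T.ΨSq_ofNat p, if_neg hodd, mul_one, Polynomial.eval_pow] at hΨ
    exact pow_eq_zero_iff two_ne_zero |>.mp hΨ
  have hsq := sq_mul_pow_le_one_of_eval_preΨ'_eq_zero O hvO MO p hp2 hpL hxd hroot
  obtain ⟨-, -, hXZ, -, -, hZ0⟩ := FormalGroupChart.val_zw (V := T) hd.1 hxd
  set Z := w (-xd / yd) with hZ
  -- `|p|² ≤ Z^{2(p-1)}`
  have hone : w xd ^ (p - 1) * Z ^ (2 * (p - 1)) = 1 := by
    rw [pow_mul, ← mul_pow, hXZ, one_pow]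
  have hfin : w (p : L) ^ 2 ≤ (Z ^ (p - 1)) ^ 2 := by
    calc w (p : L) ^ 2 = w (p : L) ^ 2 * (w xd ^ (p - 1) * Z ^ (2 * (p - 1))) := by
          rw [hone, mul_one]
      _ = (w (p : L) ^ 2 * w xd ^ (p - 1)) * Z ^ (2 * (p - 1)) := by ring
      _ ≤ 1 * Z ^ (2 * (p - 1)) := mul_le_mul_of_nonneg_right hsq zero_le
      _ = (Z ^ (p - 1)) ^ 2 := by rw [one_mul, ← pow_mul, mul_comm]
  exact le_of_pow_le_pow_left₀ two_ne_zero zero_le hfin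

end TateForm

end Literature.NumberTheory.EllipticCurves

namespace WeierstrassCurve

open Literature.NumberTheory.EllipticCurves Literature.NumberTheory.GaloisRepresentations Field
  IsDedekindDomain.HeightOneSpectrum ValuativeRel
  Literature.NumberTheory.GaloisRepresentations.IsNonarchimedeanLocalField
  Literature.NumberTheory.GaloisRepresentations.ModPGaloisRep

variable {K : Type} [Field K] [NumberField K] (W : WeierstrassCurve K)

/-- **`|a₆| = |p|^{ord_v Δ_min}` for the Tate form of invariant `j(E)` at a multiplicative
`v ∣ p` with `e(v ∣ p) = 1`.**  At a place of multiplicative reduction `|j(E)|_v = |Δ_min|_v⁻¹`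
(`j Δ = c₄³`, `c₄(E_min) ∈ 𝓞_v^×`), the Tate form `y² + xy = x³ - 36x/(j-1728) - 1/(j-1728)` has
`|a₆| = |j|⁻¹`, and `Δ_min = u pⁿ`, `u ∈ 𝓞_v^×`, `n = ord_v Δ_min`, when `p` generates `𝓂_v`.
[cite: SilvermanATAEC1994, V.5 Lemma 5.1] [cite: SilvermanAEC2009, VII.1 Prop. 1.3] -/
theorem spectralValuation_a₆_tateFormOfJ_eq_pow [W.IsElliptic] {v : HeightOneSpectrum (𝓞 K)}
    {p : ℕ} [Fact p.Prime] (hpv : (p : 𝓞 K) ∈ v.asIdeal)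
    (hmult : W.HasMultiplicativeReductionAt v)
    (hgen : ∀ c ∈ IsLocalRing.maximalIdeal (v.adicCompletionIntegers K),
      ((p : ℕ) : v.adicCompletionIntegers K) ∣ c)
    {w : Valuation (AlgebraicClosure (v.adicCompletion K)) ℝ≥0}
    (hw : ∀ x, (w x : ℝ) =
      spectralNorm (v.adicCompletion K) (AlgebraicClosure (v.adicCompletion K)) x) :
    w (((tateFormOfJ (algebraMap K (v.adicCompletion K) W.j)).baseChange
        (AlgebraicClosure (v.adicCompletion K))).a₆) =
      w ((p : ℕ) : AlgebraicClosure (v.adicCompletion K)) ^ W.ordMinimalDiscriminant v := by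
  set F := v.adicCompletion K with hF
  set L := AlgebraicClosure (v.adicCompletion K) with hL
  set f := algebraMap F L with hf
  set jv : F := algebraMap K F W.j with hjv
  have hjw : 1 < w (algebraMap K L W.j) :=
    W.one_lt_spectralValuation_j_of_hasMultiplicativeReductionAt hw hmult
  have hJ : algebraMap K L W.j = f jv := IsScalarTower.algebraMap_apply K F L W.j
  rw [hJ] at hjw
  -- `|a₆| = |j|⁻¹`
  have h1728 : w (f jv - 1728) = w (f jv) := by
    apply Valuation.map_sub_eq_of_lt_left
    calc w (1728 : L) = w ((1728 : ℕ) : L) := by norm_cast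
      _ ≤ 1 := w.map_natCast_le_one' 1728
      _ < w (f jv) := hjw
  have ha₆ : ((tateFormOfJ jv).baseChange L).a₆ = -1 / (f jv - 1728) := by
    simp [tateFormOfJ, hf, map_ofNat]
  have hwa₆ : w ((tateFormOfJ jv).baseChange L).a₆ = (w (f jv))⁻¹ := by
    rw [ha₆, map_div₀, Valuation.map_neg, map_one, h1728, one_div]
  -- `|j| |Δ_min| = |c₄(E_min)|³ = 1`
  haveI : (W.localMinimalModel v).IsElliptic := W.isElliptic_localMinimalModel v
  obtain ⟨C, hC⟩ := W.exists_variableChange_smul_eq_localMinimalModel v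
  have key : jv * (W.localMinimalModel v).Δ = (W.localMinimalModel v).c₄ ^ 3 := by
    have hj' : (C • W.baseChange F).j = jv := by
      rw [variableChange_j]
      exact W.map_j _
    rw [← hC, ← hj']
    exact (C • W.baseChange F).j_mul_Δ_eq_c₄_pow
  set I := W.localMinimalIntegralModel v with hIdef
  obtain ⟨hΔm, hc₄m⟩ := (hasMultiplicativeReductionAt_iff_mem v W).mp hmult
  have hc₄u : IsUnit I.c₄ := by
    by_contra h
    exact hc₄m ((IsLocalRing.mem_maximalIdeal _).mpr (mem_nonunits_iff.mpr h))
  have hXI : I.baseChange F = W.localMinimalModel v :=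
    baseChange_integralModel_eq (v.adicCompletionIntegers K) (W.localMinimalModel v)
  have hXc₄ : (W.localMinimalModel v).c₄ = algebraMap _ F I.c₄ := by
    rw [← hXI]; exact (I.map_c₄ _)
  have hXΔ : (W.localMinimalModel v).Δ = algebraMap _ F I.Δ := by
    rw [← hXI]; exact (I.map_Δ _)
  have hwc₄ : w (f (W.localMinimalModel v).c₄) = 1 := by
    rw [hXc₄]; exact spectralValuation_eq_one_of_isUnit hw hc₄u
  have hjΔ : w (f jv) * w (f (W.localMinimalModel v).Δ) = 1 := by
    rw [← map_mul, ← map_mul, key, map_pow, map_pow, hwc₄, one_pow]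
  -- `Δ_min = u · pⁿ` in the discrete valuation ring `𝓞_v`, `n = ord_v Δ_min`
  have hpw : w ((p : ℕ) : L) < 1 := spectralValuation_natCast_lt_one hw hpv
  have hpO : ¬ IsUnit ((p : ℕ) : v.adicCompletionIntegers K) := by
    intro hu
    have h1 := spectralValuation_eq_one_of_isUnit hw hu
    rw [map_natCast, map_natCast] at h1
    exact hpw.ne h1
  have hpirr : Irreducible ((p : ℕ) : v.adicCompletionIntegers K) := by
    rw [IsDiscreteValuationRing.irreducible_iff_uniformizer]
    apply le_antisymm
    · intro c hc
      exact Ideal.mem_span_singleton.mpr (hgen c hc)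
    · rw [Ideal.span_le, Set.singleton_subset_iff]
      exact (IsLocalRing.mem_maximalIdeal _).mpr (mem_nonunits_iff.mpr hpO)
  have hI0 : I.Δ ≠ 0 := by
    intro h0
    apply (W.localMinimalModel v).isUnit_Δ.ne_zero
    rw [hXΔ, h0, map_zero]
  obtain ⟨n, uΔ, hΔeq⟩ := IsDiscreteValuationRing.eq_unit_mul_pow_irreducible hI0 hpirr
  have hn : W.ordMinimalDiscriminant v = n := by
    rw [ordMinimalDiscriminant, ← hIdef, IsDiscreteValuationRing.addVal_def _ uΔ hpirr n hΔeq]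
    rfl
  have hwΔ : w (f (W.localMinimalModel v).Δ) = w ((p : ℕ) : L) ^ n := by
    rw [hXΔ, hΔeq, map_mul, map_mul, map_pow, map_pow, Valuation.map_mul, Valuation.map_pow,
      spectralValuation_eq_one_of_isUnit hw uΔ.isUnit, one_mul, map_natCast, map_natCast]
  -- assemble
  rw [hwa₆, hn, ← hwΔ]
  have h0 : w (f (W.localMinimalModel v).Δ) ≠ 0 := by
    intro h0; rw [h0, mul_zero] at hjΔ; exact zero_ne_one hjΔ
  rw [inv_eq_iff_eq_inv]
  exact eq_inv_of_mul_eq_one_left hjΔ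

set_option maxHeartbeats 1600000 in
/-- **Serre 1987, §2.9 Prop. 5 / (4.1.12): multiplicative reduction at `v ∣ p` with
`p ∣ ord_v(Δ_min)` ⇒ `ρ̄_{E,p}|Γ_{K_v}` is *peu ramifié*.**  Let `E` be an elliptic curve over a
number field `K`, `p` an odd prime, `v ∣ p` a finite place of multiplicative reduction at which
`p` generates the maximal ideal of `𝓞_v` (`e(v ∣ p) = 1`, e.g. `K = ℚ`) and such that
`p ∣ ord_v(Δ_min)`, `ρ̄ : Γ_K → GL₂(𝔽_p)` a framing of `E[p]` and `j : 𝔽_p → k` a ring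
homomorphism into a discrete field.  Then `(ρ̄ ⊗_j k)|Γ_{K_v}` is peu ramifiée.  See the module
docstring for the proof (Serre: "`K_v^nr(ζ_p, q^{1/p})`, `p ∣ v(q)`"; here: the criterion
`isPeuRamifie_of_forall_exists_algNorm_le` on the Tate form of invariant `j(E)`, with the
witnesses `z(Ψa)` and `x(P)/p^{n/p}`).  The hypothesis `Irreducible (p : 𝒪[K_v])` (equivalent to
`hgen`; both hold for `K = ℚ`, `SerreConjectureProofs`) names the uniformiser of the criterion.
[cite: Serre1987, §2.9 Prop. 5, (4.1.12), §2.4] [cite: SerreInventiones1972, §1.12] -/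
theorem isPeuRamifie_restrictField_of_hasMultiplicativeReductionAt_of_dvd [W.IsElliptic]
    (p : ℕ) [hp : Fact p.Prime] (hp2 : p ≠ 2)
    (v : HeightOneSpectrum (𝓞 K)) (hpv : (p : 𝓞 K) ∈ v.asIdeal)
    (hmult : W.HasMultiplicativeReductionAt v) (hdvd : p ∣ W.ordMinimalDiscriminant v)
    (hgen : ∀ c ∈ IsLocalRing.maximalIdeal (v.adicCompletionIntegers K),
      ((p : ℕ) : v.adicCompletionIntegers K) ∣ c)
    (hirr : Irreducible ((p : ℕ) : 𝒪[v.adicCompletion K]))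
    {ρ : ModPGaloisRep K (ZMod p) 2} (hρ : W.IsTorsionGaloisRep p ρ)
    {k : Type} [Field k] [TopologicalSpace k] [DiscreteTopology k] (j : ZMod p →+* k)
    (hj : Continuous j) :
    ModPGaloisRep.IsPeuRamifie
      (FramedGaloisRep.restrictField (v.adicCompletion K) (FramedRep.baseChange j hj ρ) :
        ModPGaloisRep (v.adicCompletion K) k 2) := by
  haveI : CharZero (v.adicCompletion K) :=
    charZero_of_injective_algebraMap (algebraMap K (v.adicCompletion K)).injective
  haveI : CharZero (AlgebraicClosure (v.adicCompletion K)) :=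
    charZero_of_injective_algebraMap
      (algebraMap (v.adicCompletion K) (AlgebraicClosure (v.adicCompletion K))).injective
  /- Step A: it suffices to treat `ρ̄|Γ_{K_v}` itself. -/
  suffices hF : ModPGaloisRep.IsPeuRamifie (FramedGaloisRep.restrictField (v.adicCompletion K) ρ :
      ModPGaloisRep (v.adicCompletion K) (ZMod p) 2) by
    intro u hu σ hσ
    have h1 : ρ (absGaloisRestrict K (v.adicCompletion K) σ) = 1 := hF u hu σ hσ
    apply Units.ext
    rw [FramedGaloisRep.restrictField_apply, FramedRep.coe_baseChange_apply, h1, Units.val_one,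
      Units.val_one, Matrix.map_one j (map_zero j) (map_one j)]
  /- Step B: the residue characteristic of `K_v` is `p`. -/
  have hpF : ringChar 𝓀[v.adicCompletion K] = p := by
    have hmem : ((p : ℕ) : 𝒪[v.adicCompletion K]) ∈ 𝓂[v.adicCompletion K] :=
      (IsLocalRing.mem_maximalIdeal _).mpr hirr.not_isUnit
    have h0 : ((p : ℕ) : 𝓀[v.adicCompletion K]) = 0 := by
      rw [← map_natCast (IsLocalRing.residue 𝒪[v.adicCompletion K]),
        IsLocalRing.residue_eq_zero_iff]
      exact hmem
    have hdvd' : ringChar 𝓀[v.adicCompletion K] ∣ p := (ringChar.spec _ p).mp h0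
    exact (Nat.prime_dvd_prime_iff_eq (ringChar_residueField_prime (F := v.adicCompletion K))
      hp.out).mp hdvd'
  obtain ⟨e, he⟩ := id hρ
  have hρres : ∀ τ : absoluteGaloisGroup (v.adicCompletion K),
      (FramedGaloisRep.restrictField (v.adicCompletion K) ρ :
        ModPGaloisRep (v.adicCompletion K) (ZMod p) 2) τ =
        ρ (absGaloisRestrict K (v.adicCompletion K) τ) := fun τ ↦ rfl
  have hp0 : p ≠ 0 := hp.out.ne_zero
  have hA : Nat.card (geomTorsion W p) = p ^ 2 :=
    card_torsionBy_eq_sq (E := W.baseChange (AlgebraicClosure K)) (n := p) (by exact_mod_cast hp0)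
  haveI : Finite (geomTorsion W p) := Nat.finite_of_card_ne_zero (by rw [hA]; positivity)
  -- `ρ̄(g) = 1` as soon as `g` fixes `E[p]`
  have hone_of_fix : ∀ g : Field.absoluteGaloisGroup K,
      (∀ x : geomTorsion W p, g • x = x) → ρ g = 1 := fun g hfix ↦ by
    apply Units.ext
    refine matrix_eq_one_of_forall_mulVec_eq fun x ↦ ?_
    have := he g (e.symm x)
    rw [hfix, AddEquiv.apply_symm_apply] at this
    exact this.symm
  /- Step 0: the Tate form of invariant `j` over `K_v` and the transport `Ψ : E(K̄) → T(K̄_v)`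
     (verbatim from `exists_line_le_geomTorsion_of_hasMultiplicativeReductionAt`). -/
  obtain ⟨w, hw⟩ := v.exists_spectralValuation
  obtain ⟨𝔐, h𝔐⟩ := v.localPrimesAbove_nonempty
  have hvw : w.Integers w.integer := Valuation.integer.integers w
  have hjw : 1 < w (algebraMap K (AlgebraicClosure (v.adicCompletion K)) W.j) :=
    W.one_lt_spectralValuation_j_of_hasMultiplicativeReductionAt hw hmult
  obtain ⟨hj0, hj1728, hT, ha₆, ha₆pos, ha₆lt⟩ := W.isTateForm_tateFormOfJ_of_one_lt hjw
  have ha₆v := W.spectralValuation_a₆_tateFormOfJ_eq_pow hpv hmult hgen hw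
  set jv : (v.adicCompletion K) := algebraMap K (v.adicCompletion K) W.j with hjv
  haveI hTell : (tateFormOfJ jv).IsElliptic := isElliptic_tateFormOfJ hj0 hj1728
  have hjW : (W.baseChange (v.adicCompletion K)).j = jv := W.map_j _
  have hjE : (W.baseChange (v.adicCompletion K)).j = (tateFormOfJ jv).j := by
    rw [hjW, tateFormOfJ_j hj0 hj1728]
  have hjE0 : (W.baseChange (v.adicCompletion K)).j ≠ 0 := by rw [hjW]; exact hj0
  have hjE1728 : (W.baseChange (v.adicCompletion K)).j ≠ 1728 := by rw [hjW]; exact hj1728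
  obtain ⟨eT, u, hu0, ⟨r, hr0, hur⟩, heT⟩ := exists_addEquiv_baseChange_of_j_eq_map_algEquiv_c₄c₆
    (W.baseChange (v.adicCompletion K)) (tateFormOfJ jv) (AlgebraicClosure (v.adicCompletion K))
    hjE hjE0 hjE1728
  set f := algebraMap (v.adicCompletion K) (AlgebraicClosure (v.adicCompletion K)) with hf
  obtain ⟨C, hC⟩ : ∃ C : VariableChange (v.adicCompletion K),
      W.localMinimalModel v = C • W.baseChange (v.adicCompletion K) := ⟨_, rfl⟩
  set I := W.localMinimalIntegralModel v with hIdef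
  obtain ⟨hΔm, hc₄m⟩ := (hasMultiplicativeReductionAt_iff_mem v W).mp hmult
  have hc₄u : IsUnit I.c₄ := by
    by_contra h
    exact hc₄m ((IsLocalRing.mem_maximalIdeal _).mpr (mem_nonunits_iff.mpr h))
  have hc₆u : IsUnit I.c₆ := by
    by_contra h
    have hc₆m : I.c₆ ∈ IsLocalRing.maximalIdeal _ :=
      (IsLocalRing.mem_maximalIdeal _).mpr (mem_nonunits_iff.mpr h)
    apply hc₄m
    refine Ideal.IsPrime.mem_of_pow_mem inferInstance 3 ?_
    rw [show I.c₄ ^ 3 = I.c₆ ^ 2 + 1728 * I.Δ by linear_combination -I.c_relation]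
    exact Ideal.add_mem _ (Ideal.pow_mem_of_mem _ hc₆m 2 two_pos) (Ideal.mul_mem_left _ _ hΔm)
  have hXI : I.baseChange (v.adicCompletion K) = W.localMinimalModel v :=
    baseChange_integralModel_eq (v.adicCompletionIntegers K) (W.localMinimalModel v)
  have hXc₄ : (W.localMinimalModel v).c₄ = algebraMap _ (v.adicCompletion K) I.c₄ := by
    rw [← hXI]; exact (I.map_c₄ _)
  have hXc₆ : (W.localMinimalModel v).c₆ = algebraMap _ (v.adicCompletion K) I.c₆ := by
    rw [← hXI]; exact (I.map_c₆ _)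
  have hwc₄ : w (f (W.localMinimalModel v).c₄) = 1 := by
    rw [hXc₄]; exact spectralValuation_eq_one_of_isUnit hw hc₄u
  have hwc₆ : w (f (W.localMinimalModel v).c₆) = 1 := by
    rw [hXc₆]; exact spectralValuation_eq_one_of_isUnit hw hc₆u
  have hEc₄ : (W.baseChange (v.adicCompletion K)).c₄ =
      (C.u : (v.adicCompletion K)) ^ 4 * (W.localMinimalModel v).c₄ := by
    rw [hC, variableChange_c₄, Units.val_inv_eq_inv_val, ← mul_assoc, ← mul_pow,
      mul_inv_cancel₀ C.u.ne_zero, one_pow, one_mul]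
  have hEc₆ : (W.baseChange (v.adicCompletion K)).c₆ =
      (C.u : (v.adicCompletion K)) ^ 6 * (W.localMinimalModel v).c₆ := by
    rw [hC, variableChange_c₆, Units.val_inv_eq_inv_val, ← mul_assoc, ← mul_pow,
      mul_inv_cancel₀ C.u.ne_zero, one_pow, one_mul]
  have hTc₄ : w (f (tateFormOfJ jv).c₄) = 1 := by
    rw [hf, ← map_c₄]; exact hT.valuation_c₄ w
  have hTc₆ : w (f (tateFormOfJ jv).c₆) = 1 := by
    rw [hf, ← map_c₆]; exact hT.valuation_c₆ w
  set u' : (AlgebraicClosure (v.adicCompletion K)) :=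
    u * f (r⁻¹ * (C.u : (v.adicCompletion K))⁻¹) with hu'
  have hu'2 : u' ^ 2 = f ((W.localMinimalModel v).c₆ * (tateFormOfJ jv).c₄ /
      ((W.localMinimalModel v).c₄ * (tateFormOfJ jv).c₆)) := by
    rw [hu', mul_pow, hur, ← map_pow, ← map_mul, hEc₄, hEc₆]
    congr 1
    have hCu : (C.u : (v.adicCompletion K)) ≠ 0 := C.u.ne_zero
    field_simp
  have hwu' : w u' = 1 := by
    have h2 : w u' ^ 2 = 1 := by
      rw [← Valuation.map_pow, hu'2, map_div₀, map_mul, map_mul, Valuation.map_div,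
        Valuation.map_mul, Valuation.map_mul, hwc₆, hTc₄, hwc₄, hTc₆]
      simp
    exact (pow_eq_one_iff.mp h2).resolve_right two_ne_zero
  have h2w : w (2 : (AlgebraicClosure (v.adicCompletion K))) = 1 := by
    have := spectralValuation_intCast_eq_one hw (two_not_mem_asIdeal_of_prime_mem hp.out hp2 hpv)
    simpa using this
  have hfixu : ∀ σ ∈ 𝔐.inertia (absoluteGaloisGroup (v.adicCompletion K)),
      absoluteGaloisGroup.toAlgEquiv (v.adicCompletion K) σ u = u := by
    intro σ hσ
    set σE : (AlgebraicClosure (v.adicCompletion K)) ≃ₐ[(v.adicCompletion K)]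
      (AlgebraicClosure (v.adicCompletion K)) := absoluteGaloisGroup.toAlgEquiv _ σ with hσE
    rcases (heT σE).1 with hfix | hneg
    · exact hfix
    · exfalso
      have hσu' : σE u' = -u' := by
        rw [hu', map_mul, hneg, AlgEquiv.commutes, neg_mul]
      have hlt := (mem_inertia_iff_spectralValuation hw h𝔐).mp hσ u' hwu'.le
      have heq : σ • u' - u' = -(2 * u') := by
        change σE u' - u' = -(2 * u')
        rw [hσu']; ring
      rw [heq, Valuation.map_neg, Valuation.map_mul, h2w, hwu', one_mul] at hlt
      exact lt_irrefl _ hlt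
  haveI hint : ((tateFormOfJ jv).baseChange (AlgebraicClosure (v.adicCompletion K))).IsIntegral
      w.integer := hT.isIntegral
  let Φ : localPoints W (v.adicCompletion K) ≃+
      ((tateFormOfJ jv).baseChange (AlgebraicClosure (v.adicCompletion K))).toAffine.Point :=
    (Affine.Point.congrEquiv (baseChange_baseChange_adicCompletion W v).symm).trans eT
  have hΦ : ∀ σ ∈ 𝔐.inertia (absoluteGaloisGroup (v.adicCompletion K)),
      ∀ Q : localPoints W (v.adicCompletion K),
      Φ (σ • Q) = Affine.Point.map ((absoluteGaloisGroup.toAlgEquiv (v.adicCompletion K) σ :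
        (AlgebraicClosure (v.adicCompletion K)) ≃ₐ[(v.adicCompletion K)]
          (AlgebraicClosure (v.adicCompletion K))) :
        (AlgebraicClosure (v.adicCompletion K)) →ₐ[(v.adicCompletion K)]
          (AlgebraicClosure (v.adicCompletion K))) (Φ Q) := by
    intro σ hσ Q
    change eT (Affine.Point.congrEquiv (baseChange_baseChange_adicCompletion W v).symm (σ • Q)) =
      Affine.Point.map ((absoluteGaloisGroup.toAlgEquiv (v.adicCompletion K) σ :
        (AlgebraicClosure (v.adicCompletion K)) ≃ₐ[(v.adicCompletion K)]
          (AlgebraicClosure (v.adicCompletion K))) :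
        (AlgebraicClosure (v.adicCompletion K)) →ₐ[(v.adicCompletion K)]
          (AlgebraicClosure (v.adicCompletion K)))
        (eT (Affine.Point.congrEquiv (baseChange_baseChange_adicCompletion W v).symm Q))
    rw [congrEquiv_smul, (heT _).2, if_pos (hfixu σ hσ)]
  set Ψ : geomPoints W →+
      ((tateFormOfJ jv).baseChange (AlgebraicClosure (v.adicCompletion K))).toAffine.Point :=
    Φ.toAddMonoidHom.comp (pointsMap W (v.adicCompletion K)) with hΨ
  have hΨinj : Function.Injective Ψ :=
    Φ.injective.comp (pointsMapOfEmb_injective W (closureEmb (K := K) (v.adicCompletion K)))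
  obtain ⟨M, hM⟩ := hint.integral
  set X : AddSubgroup (geomTorsion W (p : ℤ)) :=
    { carrier := {P | M.ReducesToZero (Affine.Point.congrEquiv hM (Ψ (P : geomPoints W)))}
      zero_mem' := by
        simp only [Set.mem_setOf_eq, ZeroMemClass.coe_zero, map_zero]
        exact reducesToZero_zero
      add_mem' := by
        intro P Q hP hQ
        simp only [Set.mem_setOf_eq, AddSubgroup.coe_add, map_add] at hP hQ ⊢
        exact hP.add hvw hQ
      neg_mem' := by
        intro P hP
        simp only [Set.mem_setOf_eq, AddSubgroup.coe_neg, map_neg] at hP ⊢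
        exact hP.neg } with hXdef
  have hmemX : ∀ P : geomTorsion W (p : ℤ),
      P ∈ X ↔ M.ReducesToZero (Affine.Point.congrEquiv hM (Ψ (P : geomPoints W))) :=
    fun P ↦ Iff.rfl
  have hpL : (p : (AlgebraicClosure (v.adicCompletion K))) ≠ 0 := Nat.cast_ne_zero.mpr hp0
  have hpw : w (p : (AlgebraicClosure (v.adicCompletion K))) < 1 :=
    spectralValuation_natCast_lt_one hw hpv
  have hT' : TateForm.IsTateForm w (M.baseChange (AlgebraicClosure (v.adicCompletion K))) := by
    rw [← hM]; exact hT
  /- Step 1: the Galois plumbing — `Ψ(res τ • P) = (Ψ P)^τ` for `τ ∈ I_{K_v}`. -/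
  have hΨτ : ∀ τ ∈ absInertia (v.adicCompletion K), ∀ P : geomPoints W,
      Ψ (absGaloisRestrict K (v.adicCompletion K) τ • P) =
        Affine.Point.map ((absoluteGaloisGroup.toAlgEquiv (v.adicCompletion K) τ :
          (AlgebraicClosure (v.adicCompletion K)) ≃ₐ[(v.adicCompletion K)]
            (AlgebraicClosure (v.adicCompletion K))) :
          (AlgebraicClosure (v.adicCompletion K)) →ₐ[(v.adicCompletion K)]
            (AlgebraicClosure (v.adicCompletion K))) (Ψ P) := by
    intro τ hτ P
    have hτI : τ ∈ 𝔐.inertia (absoluteGaloisGroup (v.adicCompletion K)) := by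
      rwa [inertia_eq_absInertia hw h𝔐]
    rw [hΨ, AddMonoidHom.coe_comp, Function.comp_apply, ← resGal_eq_absGaloisRestrict,
      pointsMap_smul]
    exact hΦ τ hτI _
  -- every `σ ∈ Γ_{K_v}` acts on `K̄_v` as a `w`-isometry
  have hσw : ∀ (τ : absoluteGaloisGroup (v.adicCompletion K))
      (z : AlgebraicClosure (v.adicCompletion K)),
      w (absoluteGaloisGroup.toAlgEquiv (v.adicCompletion K) τ z) = w z :=
    fun τ z ↦ spectralValuation_smul hw τ z
  /- Step 2: `P ∈ X ↔ Ψ P` is not small; `τ P - P ∈ X` for `τ ∈ I_{K_v}`; `#X ≤ p`. -/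
  set Ψ' : geomTorsion W (p : ℤ) →+
      ((tateFormOfJ jv).baseChange (AlgebraicClosure (v.adicCompletion K))).toAffine.Point :=
    Ψ.comp (geomTorsion W (p : ℤ)).subtype with hΨ'
  have hΨ'inj : Function.Injective Ψ' := hΨinj.comp Subtype.val_injective
  have hΨ'apply : ∀ P : geomTorsion W (p : ℤ), Ψ' P = Ψ (P : geomPoints W) := fun P ↦ rfl
  have hpΨ' : ∀ P : geomTorsion W (p : ℤ), (p : ℤ) • Ψ' P = 0 := fun P ↦ by
    have hP0 : ((p : ℕ) : ℤ) • (P : geomPoints W) = 0 := (Submodule.mem_torsionBy_iff _ _).mp P.2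
    rw [hΨ'apply, ← map_zsmul, hP0, map_zero]
  -- `P ∈ X ↔ Ψ P` not small
  have hXiff : ∀ P : geomTorsion W (p : ℤ), P ∈ X ↔ ¬ TateForm.IsSmall w (Ψ' P) := by
    intro P
    rw [hmemX, ← hΨ'apply]
    constructor
    · intro hred
      rcases hP : Ψ' P with _ | ⟨x, y, hxy⟩
      · exact TateForm.not_isSmall_zero
      · rw [hP, Affine.Point.congrEquiv_some, reducesToZero_some_iff, not_mem_range_iff hvw] at hred
        rw [TateForm.isSmall_some, not_lt]
        exact hred.le
    · intro hns
      have hQm : ((p ^ 1 : ℕ) : ℤ) • Ψ' P = 0 := by rw [pow_one]; exact hpΨ' P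
      exact TateForm.reducesToZero_congrEquiv_of_not_isSmall hM hT' hpw hns hQm
  -- affine points of `Ψ'(X)` lie in the kernel of reduction
  have hXker : ∀ P : geomTorsion W (p : ℤ), P ∈ X → ∀ {x y}
      {hxy : ((tateFormOfJ jv).baseChange
        (AlgebraicClosure (v.adicCompletion K))).toAffine.Nonsingular x y},
      Ψ' P = .some x y hxy → 1 < w x := by
    intro P hP x y hxy hPeq
    have hred := (hmemX P).mp hP
    rw [← hΨ'apply, hPeq, Affine.Point.congrEquiv_some, reducesToZero_some_iff,
      not_mem_range_iff hvw] at hred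
    exact hred
  -- `τ P - P ∈ X` for `τ ∈ I_{K_v}`
  have hquotX : ∀ τ ∈ absInertia (v.adicCompletion K), ∀ P : geomTorsion W (p : ℤ),
      absGaloisRestrict K (v.adicCompletion K) τ • P - P ∈ X := by
    intro τ hτ P
    set σE : (AlgebraicClosure (v.adicCompletion K)) ≃ₐ[(v.adicCompletion K)]
      (AlgebraicClosure (v.adicCompletion K)) := absoluteGaloisGroup.toAlgEquiv _ τ with hσE
    have hcoe : ((absGaloisRestrict K (v.adicCompletion K) τ • P - P : geomTorsion W (p : ℤ)) :
        geomPoints W) = absGaloisRestrict K (v.adicCompletion K) τ • (P : geomPoints W) - P := by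
      rw [AddSubgroupClass.coe_sub,
        Literature.NumberTheory.EllipticCurves.AddSubgroup.torsionBy.coe_smul]
    rw [hmemX, hcoe, map_sub, hΨτ τ hτ]
    have hP0 : ((p ^ 1 : ℕ) : ℤ) • Ψ (P : geomPoints W) = 0 := by
      rw [pow_one, ← map_zsmul, (Submodule.mem_torsionBy_iff _ _).mp P.2, map_zero]
    rcases hD : Affine.Point.map (σE : (AlgebraicClosure (v.adicCompletion K))
        →ₐ[(v.adicCompletion K)] (AlgebraicClosure (v.adicCompletion K))) (Ψ P) - Ψ P with
      _ | ⟨s, t, hst⟩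
    · rw [← Affine.Point.zero_def, map_zero]
      exact reducesToZero_zero
    · have hs : 1 < w s :=
        TateForm.one_lt_valuation_of_map_sub_eq_some_of_zsmul_eq_zero (tateFormOfJ jv) hT ha₆
          hp2 hpw σE (hσw τ) (Ψ P) hP0 hD
      rw [Affine.Point.congrEquiv_some, reducesToZero_some_iff, not_mem_range_iff hvw]
      exact hs
  have hstabX : ∀ τ ∈ absInertia (v.adicCompletion K), ∀ P : geomTorsion W (p : ℤ), P ∈ X →
      absGaloisRestrict K (v.adicCompletion K) τ • P ∈ X := by
    intro τ hτ P hP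
    have h := X.add_mem (hquotX τ hτ P) hP
    rwa [sub_add_cancel] at h
  -- `#X ≤ p`
  have hcardX : Nat.card X ≤ p := by
    set G := X.map Ψ' with hG
    have hGfin : (G : Set ((tateFormOfJ jv).baseChange
        (AlgebraicClosure (v.adicCompletion K))).toAffine.Point).Finite := by
      rw [hG, AddSubgroup.coe_map]
      exact (Set.toFinite _).image Ψ'
    haveI : Finite G := hGfin.to_subtype
    have hcard : Nat.card X = Nat.card G :=
      Nat.card_congr (X.equivMapOfInjective Ψ' hΨ'inj).toEquiv
    rw [hcard]
    have hbound := TateForm.card_addSubgroup_le_pow (tateFormOfJ jv) hT hp2 hpw hpL 1 G ?_ ?_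
    · simpa using hbound
    · intro x y h hmem
      obtain ⟨P, hP, hPeq⟩ := AddSubgroup.mem_map.mp hmem
      exact hXker P hP hPeq
    · intro Q hmem
      obtain ⟨P, -, rfl⟩ := AddSubgroup.mem_map.mp hmem
      rw [pow_one]
      exact hpΨ' P
  -- if `X = ⊥` the inertia group acts trivially
  have htriv : X = ⊥ → ∀ τ ∈ absInertia (v.adicCompletion K),
      ρ (absGaloisRestrict K (v.adicCompletion K) τ) = 1 := by
    intro hbot τ hτ
    refine hone_of_fix _ fun x ↦ ?_
    have h := hquotX τ hτ x
    rw [hbot, AddSubgroup.mem_bot, sub_eq_zero] at h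
    exact h
  refine ModPGaloisRep.isPeuRamifie_of_forall_exists_algNorm_le _ hpF hirr ?_ ?_
  · /- Step 3: `#ρ̄(I_{K_v}) ≤ p (p - 1)`. -/
    by_cases hbot : X = ⊥
    · have hmap : (absInertia (v.adicCompletion K)).map
          (FramedGaloisRep.restrictField (v.adicCompletion K) ρ :
            ModPGaloisRep (v.adicCompletion K) (ZMod p) 2).toMonoidHom = ⊥ := by
        rw [Subgroup.map_eq_bot_iff]
        intro τ hτ
        exact htriv hbot τ hτ
      rw [hmap, Subgroup.card_bot]
      have := hp.out.two_le
      calc 1 ≤ 2 * (2 - 1) := by norm_num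
        _ ≤ p * (p - 1) := Nat.mul_le_mul this (Nat.sub_le_sub_right this 1)
    · -- `#X = p`, the triangular form, and the injection `g ↦ (det g, (Q⁻¹ g Q)₀₁)`
      have hcardXp : Nat.card X = p := by
        have hdvdX : Nat.card X ∣ p ^ 2 := hA ▸ X.card_addSubgroup_dvd_card
        obtain ⟨i, hi, hci⟩ := (Nat.dvd_prime_pow hp.out).mp hdvdX
        interval_cases i
        · exfalso
          rw [pow_zero] at hci
          exact hbot (AddSubgroup.eq_bot_of_card_eq X hci)
        · rw [hci, pow_one]
        · exfalso
          rw [hci] at hcardX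
          have : p ^ 2 ≤ p ^ 1 := by rwa [pow_one]
          exact absurd (Nat.pow_le_pow_iff_right hp.out.one_lt |>.mp this) (by norm_num)
      set Λ : AddSubgroup (geomPoints W) := X.map (geomTorsion W (p : ℤ)).subtype with hΛdef
      have hΛ : Λ ≤ geomTorsion W (p : ℤ) := by
        rintro _ ⟨P, -, rfl⟩
        exact P.2
      have hcardΛ : Nat.card Λ = p := by
        rw [← hcardXp]
        exact (Nat.card_congr (X.equivMapOfInjective (geomTorsion W (p : ℤ)).subtype
          Subtype.val_injective).toEquiv).symm
      have hstabΛ : ∀ τ ∈ absInertia (v.adicCompletion K), ∀ x ∈ Λ,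
          absGaloisRestrict K (v.adicCompletion K) τ • x ∈ Λ := by
        rintro τ hτ _ ⟨P, hP, rfl⟩
        exact ⟨absGaloisRestrict K (v.adicCompletion K) τ • P, hstabX τ hτ P hP,
          Literature.NumberTheory.EllipticCurves.AddSubgroup.torsionBy.coe_smul _ _⟩
      have hquotΛ : ∀ τ ∈ absInertia (v.adicCompletion K), ∀ x ∈ geomTorsion W (p : ℤ),
          absGaloisRestrict K (v.adicCompletion K) τ • x - x ∈ Λ := by
        intro τ hτ P₀ hP₀
        set P : geomTorsion W (p : ℤ) := ⟨P₀, hP₀⟩ with hPdef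
        have hcoe : ((absGaloisRestrict K (v.adicCompletion K) τ • P - P :
            geomTorsion W (p : ℤ)) : geomPoints W) =
            absGaloisRestrict K (v.adicCompletion K) τ • (P : geomPoints W) - P := by
          rw [AddSubgroupClass.coe_sub,
            Literature.NumberTheory.EllipticCurves.AddSubgroup.torsionBy.coe_smul]
        change absGaloisRestrict K (v.adicCompletion K) τ • (P : geomPoints W) - P ∈ Λ
        exact AddSubgroup.mem_map.mpr ⟨_, hquotX τ hτ P, by rw [AddSubgroup.coe_subtype, hcoe]⟩
      obtain ⟨Q, hQ⟩ := IsTorsionGaloisRep.exists_conj_eq_of_line hρ hΛ hcardΛ hstabΛ hquotΛ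
      let ψ : ↥((absInertia (v.adicCompletion K)).map
          (FramedGaloisRep.restrictField (v.adicCompletion K) ρ :
            ModPGaloisRep (v.adicCompletion K) (ZMod p) 2).toMonoidHom) → (ZMod p)ˣ × ZMod p :=
        fun g ↦ (Matrix.GeneralLinearGroup.det g.1,
          ((Q⁻¹ * g.1 * Q : GL (Fin 2) (ZMod p)) : Matrix (Fin 2) (Fin 2) (ZMod p)) 0 1)
      have hψ : Function.Injective ψ := by
        rintro ⟨g, hg⟩ ⟨g', hg'⟩ hgg'
        obtain ⟨τ, hτ, rfl⟩ := Subgroup.mem_map.mp hg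
        obtain ⟨τ', hτ', rfl⟩ := Subgroup.mem_map.mp hg'
        obtain ⟨c, hc⟩ := hQ τ hτ
        obtain ⟨c', hc'⟩ := hQ τ' hτ'
        simp only [ψ, Prod.mk.injEq] at hgg'
        obtain ⟨hdet, h01⟩ := hgg'
        change Matrix.GeneralLinearGroup.det (ρ (absGaloisRestrict K (v.adicCompletion K) τ)) =
          Matrix.GeneralLinearGroup.det (ρ (absGaloisRestrict K (v.adicCompletion K) τ')) at hdet
        change ((Q⁻¹ * ρ (absGaloisRestrict K (v.adicCompletion K) τ) * Q : GL (Fin 2) (ZMod p)) :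
            Matrix (Fin 2) (Fin 2) (ZMod p)) 0 1 =
          ((Q⁻¹ * ρ (absGaloisRestrict K (v.adicCompletion K) τ') * Q : GL (Fin 2) (ZMod p)) :
            Matrix (Fin 2) (Fin 2) (ZMod p)) 0 1 at h01
        rw [hc, hc'] at h01
        have hcc : c = c' := by simpa using h01
        have hM' : (Q⁻¹ * ρ (absGaloisRestrict K (v.adicCompletion K) τ) * Q :
            GL (Fin 2) (ZMod p)) = Q⁻¹ * ρ (absGaloisRestrict K (v.adicCompletion K) τ') * Q := by
          apply Units.ext
          rw [hc, hc', hdet, hcc]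
        apply Subtype.ext
        change ρ (absGaloisRestrict K (v.adicCompletion K) τ) =
          ρ (absGaloisRestrict K (v.adicCompletion K) τ')
        have := congrArg (fun M : GL (Fin 2) (ZMod p) ↦ Q * M * Q⁻¹) hM'
        simpa [mul_assoc] using this
      calc Nat.card _ ≤ Nat.card ((ZMod p)ˣ × ZMod p) := Nat.card_le_card_of_injective ψ hψ
        _ = p * (p - 1) := by
          rw [Nat.card_prod, Nat.card_zmod, Nat.card_eq_fintype_card, ZMod.card_units_eq_totient,
            Nat.totient_prime hp.out, mul_comm]
  · /- Step 4: the valuation witnesses. -/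
    intro τ hτ hτ1
    rw [hρres] at hτ1
    set g := absGaloisRestrict K (v.adicCompletion K) τ with hgdef
    have hXne : X ≠ ⊥ := fun hb ↦ hτ1 (htriv hb τ hτ)
    let σE : AlgebraicClosure (v.adicCompletion K) →ₐ[v.adicCompletion K]
        AlgebraicClosure (v.adicCompletion K) :=
      ((absoluteGaloisGroup.toAlgEquiv (v.adicCompletion K) τ :
          AlgebraicClosure (v.adicCompletion K) ≃ₐ[v.adicCompletion K]
            AlgebraicClosure (v.adicCompletion K)) :
        AlgebraicClosure (v.adicCompletion K) →ₐ[v.adicCompletion K]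
          AlgebraicClosure (v.adicCompletion K))
    have hσE : ∀ z, σE z = τ • z := fun z ↦ rfl
    have hΨg : ∀ P : geomTorsion W (p : ℤ), Ψ' (g • P) = Affine.Point.map σE (Ψ' P) := by
      intro P
      rw [hΨ'apply, hΨ'apply, Literature.NumberTheory.EllipticCurves.AddSubgroup.torsionBy.coe_smul,
        hgdef, hΨτ τ hτ]
    -- every `σ ∈ Γ_{K_v}` transports `Ψ` up to the sign of the twist
    have hΨσ : ∀ (σ : absoluteGaloisGroup (v.adicCompletion K)) (P : geomPoints W),
        Ψ (absGaloisRestrict K (v.adicCompletion K) σ • P) =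
          Affine.Point.map ((absoluteGaloisGroup.toAlgEquiv (v.adicCompletion K) σ :
            (AlgebraicClosure (v.adicCompletion K)) ≃ₐ[(v.adicCompletion K)]
              (AlgebraicClosure (v.adicCompletion K))) :
            (AlgebraicClosure (v.adicCompletion K)) →ₐ[(v.adicCompletion K)]
              (AlgebraicClosure (v.adicCompletion K))) (Ψ P) ∨
        Ψ (absGaloisRestrict K (v.adicCompletion K) σ • P) =
          -Affine.Point.map ((absoluteGaloisGroup.toAlgEquiv (v.adicCompletion K) σ :
            (AlgebraicClosure (v.adicCompletion K)) ≃ₐ[(v.adicCompletion K)]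
              (AlgebraicClosure (v.adicCompletion K))) :
            (AlgebraicClosure (v.adicCompletion K)) →ₐ[(v.adicCompletion K)]
              (AlgebraicClosure (v.adicCompletion K))) (Ψ P) := by
      intro σ P
      set σ' : (AlgebraicClosure (v.adicCompletion K)) ≃ₐ[(v.adicCompletion K)]
        (AlgebraicClosure (v.adicCompletion K)) := absoluteGaloisGroup.toAlgEquiv _ σ with hσ'
      have key : Ψ (absGaloisRestrict K (v.adicCompletion K) σ • P) =
          if σ' u = u then Affine.Point.map (σ' : (AlgebraicClosure (v.adicCompletion K))
              →ₐ[(v.adicCompletion K)] (AlgebraicClosure (v.adicCompletion K))) (Ψ P)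
          else -Affine.Point.map (σ' : (AlgebraicClosure (v.adicCompletion K))
              →ₐ[(v.adicCompletion K)] (AlgebraicClosure (v.adicCompletion K))) (Ψ P) := by
        rw [hΨ, AddMonoidHom.coe_comp, Function.comp_apply, Function.comp_apply,
          ← resGal_eq_absGaloisRestrict, pointsMap_smul]
        change eT (Affine.Point.congrEquiv (baseChange_baseChange_adicCompletion W v).symm
            (σ • pointsMap W (v.adicCompletion K) P)) =
          if σ' u = u then Affine.Point.map (σ' : (AlgebraicClosure (v.adicCompletion K))
              →ₐ[(v.adicCompletion K)] (AlgebraicClosure (v.adicCompletion K)))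
              (eT (Affine.Point.congrEquiv (baseChange_baseChange_adicCompletion W v).symm
                (pointsMap W (v.adicCompletion K) P)))
          else -Affine.Point.map (σ' : (AlgebraicClosure (v.adicCompletion K))
              →ₐ[(v.adicCompletion K)] (AlgebraicClosure (v.adicCompletion K)))
              (eT (Affine.Point.congrEquiv (baseChange_baseChange_adicCompletion W v).symm
                (pointsMap W (v.adicCompletion K) P)))
        rw [congrEquiv_smul, (heT _).2]
      by_cases hu : σ' u = u
      · left; rw [key, if_pos hu]
      · right; rw [key, if_neg hu]
    -- `x`-coordinates of `Ψ`-images of `E[p]` are fixed by `ker ρ̄|Γ_{K_v}`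
    have hfixx : ∀ σ : absoluteGaloisGroup (v.adicCompletion K),
        (FramedGaloisRep.restrictField (v.adicCompletion K) ρ :
          ModPGaloisRep (v.adicCompletion K) (ZMod p) 2) σ = 1 →
        ∀ (P : geomTorsion W (p : ℤ)) {x y}
          {hxy : ((tateFormOfJ jv).baseChange
            (AlgebraicClosure (v.adicCompletion K))).toAffine.Nonsingular x y},
          Ψ' P = .some x y hxy → σ • x = x := by
      intro σ hσ P x y hxy hPeq
      rw [hρres] at hσ
      have hfix : absGaloisRestrict K (v.adicCompletion K) σ • P = P := by
        have h1 := he (absGaloisRestrict K (v.adicCompletion K) σ) P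
        rw [hσ, Units.val_one, Matrix.one_mulVec] at h1
        exact e.injective h1
      have h2 : Ψ (absGaloisRestrict K (v.adicCompletion K) σ • (P : geomPoints W)) = Ψ' P := by
        rw [← Literature.NumberTheory.EllipticCurves.AddSubgroup.torsionBy.coe_smul, hfix, hΨ'apply]
      rcases hΨσ σ (P : geomPoints W) with h3 | h3 <;>
        rw [h2, hPeq, ← hΨ'apply, hPeq, Affine.Point.map_some] at h3
      · exact (((Affine.Point.some.injEq _ _ _ _ _ _).mp h3).1).symm
      · rw [Affine.Point.neg_some] at h3
        exact (((Affine.Point.some.injEq _ _ _ _ _ _).mp h3).1).symm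
    -- the kernel estimate for `Ψ' δ`, `δ ∈ X ∖ 0`
    have hzest : ∀ δ : geomTorsion W (p : ℤ), δ ∈ X → δ ≠ 0 →
        ∃ (xd yd : AlgebraicClosure (v.adicCompletion K))
          (hd : ((tateFormOfJ jv).baseChange
            (AlgebraicClosure (v.adicCompletion K))).toAffine.Nonsingular xd yd),
          Ψ' δ = .some xd yd hd ∧ 1 < w xd ∧
            w (p : AlgebraicClosure (v.adicCompletion K)) ≤ w (-xd / yd) ^ (p - 1) := by
      intro δ hδX hδ0
      rcases hD : Ψ' δ with _ | ⟨xd, yd, hd⟩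
      · exfalso
        apply hδ0
        apply hΨ'inj
        rw [hD, ← Affine.Point.zero_def, map_zero]
      · have hxd : 1 < w xd := hXker δ hδX hD
        have hpD : (p : ℤ) • (Affine.Point.some xd yd hd : ((tateFormOfJ jv).baseChange
            (AlgebraicClosure (v.adicCompletion K))).toAffine.Point) = 0 := by
          rw [← hD]; exact hpΨ' δ
        exact ⟨xd, yd, hd, rfl, hxd, TateForm.valuation_natCast_le_pow_of_one_lt hT hp2 hpL hxd hpD⟩
    /- Step 5: a top small point `x₁`, its level `|x_P|^p = |a₆|`. -/
    haveI : Fintype (geomTorsion W (p : ℤ)) := Fintype.ofFinite _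
    set S : Finset (geomTorsion W (p : ℤ)) :=
      Finset.univ.filter (fun P ↦ TateForm.IsSmall w (Ψ' P)) with hSdef
    have hmemS : ∀ P, P ∈ S ↔ TateForm.IsSmall w (Ψ' P) := fun P ↦ by simp [hSdef]
    have hSne : S.Nonempty := by
      by_contra hno
      rw [Finset.not_nonempty_iff_eq_empty] at hno
      have hall : ∀ P : geomTorsion W (p : ℤ), P ∈ X := fun P ↦ by
        rw [hXiff]
        intro hs
        have : P ∈ S := (hmemS P).mpr hs
        rw [hno] at this
        exact Finset.notMem_empty _ this
      have htop : X = ⊤ := (AddSubgroup.eq_top_iff' X).mpr hall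
      have hcard : Nat.card X = p ^ 2 := by rw [htop, AddSubgroup.card_top, hA]
      rw [hcard] at hcardX
      have h1 := hp.out.one_lt
      exact absurd hcardX (by rw [not_le]; calc p = p ^ 1 := (pow_one p).symm
        _ < p ^ 2 := Nat.pow_lt_pow_right h1 (by norm_num))
    let lev : ((tateFormOfJ jv).baseChange (AlgebraicClosure (v.adicCompletion K))).toAffine.Point →
        ℝ≥0 := fun P ↦ match P with
      | .zero => 0
      | @WeierstrassCurve.Affine.Point.some _ _ _ x _ _ => w x
    obtain ⟨x₁, hx₁S, hmax⟩ := S.exists_max_image (fun P ↦ lev (Ψ' P)) hSne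
    have hx₁small := (hmemS x₁).mp hx₁S
    rcases hP1 : Ψ' x₁ with _ | ⟨xP, yP, hP⟩
    · rw [hP1] at hx₁small
      exact (TateForm.not_isSmall_zero (hx₁small : TateForm.IsSmall w
        (0 : ((tateFormOfJ jv).baseChange
          (AlgebraicClosure (v.adicCompletion K))).toAffine.Point))).elim
    rw [hP1, TateForm.isSmall_some] at hx₁small
    have hxP1 : w xP < 1 := hx₁small
    have hx₁X : x₁ ∉ X := by
      rw [hXiff, not_not, hP1, TateForm.isSmall_some]; exact hxP1
    have hx₁0 : x₁ ≠ 0 := by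
      intro h0
      rw [h0, map_zero] at hP1
      exact Affine.Point.some_ne_zero _ hP1.symm
    have hpx₁ : p • x₁ = 0 := by
      rw [← natCast_zsmul]
      exact Subtype.ext ((Submodule.mem_torsionBy_iff _ _).mp x₁.2)
    -- `|x_P|^p = |a₆|`
    have hlev : w xP ^ p =
        w ((tateFormOfJ jv).baseChange (AlgebraicClosure (v.adicCompletion K))).a₆ := by
      refine TateForm.pow_addOrderOf_eq_of_top hT ha₆ hp.out hp2 (h := hP) hxP1 ?_ ?_ ?_
      · rw [← hP1, addOrderOf_injective Ψ' hΨ'inj, addOrderOf_eq_prime hpx₁ hx₁0]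
      · intro k x' y' h' hk hx'
        rw [← hP1, ← map_nsmul] at hk
        have hkS : k • x₁ ∈ S := by
          rw [hmemS, hk, TateForm.isSmall_some]; exact hx'
        have := hmax (k • x₁) hkS
        rw [hk, hP1] at this
        exact this
      · intro k hk
        rw [← hP1, ← map_nsmul] at hk ⊢
        have hkX : k • x₁ ∈ X := (hXiff _).mpr hk
        have hpk : p ∣ k := by
          by_contra hndvd
          apply hx₁X
          have hcop : IsCoprime (k : ℤ) (p : ℤ) := by
            rw [Nat.isCoprime_iff_coprime]
            exact (Nat.coprime_comm).mp ((Nat.Prime.coprime_iff_not_dvd hp.out).mpr hndvd)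
          obtain ⟨a, b, hab⟩ := hcop
          have hx₁eq : x₁ = a • (k • x₁) + b • (p • x₁) := by
            rw [← natCast_zsmul, ← natCast_zsmul, smul_smul, smul_smul, ← add_smul, hab,
              one_smul]
          rw [hx₁eq, hpx₁, smul_zero, add_zero]
          exact X.zsmul_mem hkX a
        obtain ⟨m, rfl⟩ := hpk
        rw [mul_comm, mul_smul, hpx₁, smul_zero, map_zero]
    have hxP0 : 0 < w xP := by
      refine lt_of_le_of_ne zero_le fun h0 ↦ ?_
      rw [← h0, zero_pow hp0] at hlev
      exact ha₆pos.ne hlev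
    have hmidP : w ((tateFormOfJ jv).baseChange (AlgebraicClosure (v.adicCompletion K))).a₆ <
        w xP ^ 2 := by
      rw [← hlev]
      exact pow_lt_pow_right_of_lt_one₀ hxP0 hxP1 (by have := hp.out.two_le; omega)
    /- Step 6: a small point `b` at the top level, on the first branch, MOVED by `τ`. -/
    -- first: `x₁` or `-x₁` on the first branch
    obtain ⟨b₁, yb, hb₁, hΨb₁, hyb⟩ : ∃ (b₁ : geomTorsion W (p : ℤ))
        (yb : AlgebraicClosure (v.adicCompletion K))
        (hb₁ : ((tateFormOfJ jv).baseChange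
          (AlgebraicClosure (v.adicCompletion K))).toAffine.Nonsingular xP yb),
        Ψ' b₁ = .some xP yb hb₁ ∧ w yb < w xP := by
      rcases TateForm.branch hT hP.1 hxP1 hmidP with hb | hb
      · exact ⟨x₁, yP, hP, hP1, hb.1⟩
      · refine ⟨-x₁, _, (Affine.nonsingular_neg ..).mpr hP, by rw [map_neg, hP1]; rfl, ?_⟩
        rw [hT.negY, show -yP - xP = -(yP + xP) by ring, Valuation.map_neg]
        exact hb.1
    -- second: a moved small point at level `|x_P|` (`b₁`, or `b₁ + a` with `a ∈ X` moved)
    obtain ⟨b₀, xc, yc, hc, hΨb₀, hxc, hgb₀⟩ : ∃ (b₀ : geomTorsion W (p : ℤ))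
        (xc yc : AlgebraicClosure (v.adicCompletion K))
        (hc : ((tateFormOfJ jv).baseChange
          (AlgebraicClosure (v.adicCompletion K))).toAffine.Nonsingular xc yc),
        Ψ' b₀ = .some xc yc hc ∧ w xc = w xP ∧ g • b₀ ≠ b₀ := by
      by_cases hgb : g • b₁ = b₁
      · -- `τ` fixes `b₁`; it moves some `a ∈ X` (else it fixes `X ⊕ ⟨b₁⟩ = E[p]`)
        have hb₁X : b₁ ∉ X := by
          rw [hXiff, not_not, hΨb₁, TateForm.isSmall_some]; exact hxP1
        obtain ⟨a, haX, hga⟩ : ∃ a ∈ X, g • a ≠ a := by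
          by_contra hno
          push Not at hno
          obtain ⟨a₀, ha₀X, ha₀0⟩ : ∃ a₀ ∈ X, a₀ ≠ 0 := by
            by_contra hno'
            push Not at hno'
            exact hXne ((AddSubgroup.eq_bot_iff_forall _).mpr hno')
          apply hτ1
          refine hone_of_fix g fun x ↦ ?_
          -- the fixed subgroup of `g` contains `E[p]`
          set Fix : AddSubgroup (geomPoints W) :=
            { carrier := {x | g • x = x}
              zero_mem' := smul_zero g
              add_mem' := fun {x y} hx hy ↦ by
                simp only [Set.mem_setOf_eq] at hx hy ⊢
                rw [smul_add, hx, hy]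
              neg_mem' := fun {x} hx ↦ by
                simp only [Set.mem_setOf_eq] at hx ⊢
                rw [smul_neg, hx] } with hFix
          have hle : geomTorsion W (p : ℤ) ≤ Fix := by
            refine addSubgroup_le_of_card_eq_sq hp.out (H := geomTorsion W (p : ℤ))
              (E := X.map (geomTorsion W (p : ℤ)).subtype) (F := Fix) hA (T := (a₀ : geomPoints W))
              (P := (b₁ : geomPoints W)) a₀.2 b₁.2 ?_ ?_ ⟨a₀, ha₀X, rfl⟩ ?_ ?_ ?_
            · exact fun h ↦ ha₀0 (Subtype.ext h)
            · rw [← natCast_zsmul]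
              exact (Submodule.mem_torsionBy_iff _ _).mp a₀.2
            · rintro ⟨P, hP, hPeq⟩
              rw [AddSubgroup.coe_subtype] at hPeq
              rw [Subtype.val_injective hPeq] at hP
              exact hb₁X hP
            · change g • (a₀ : geomPoints W) = a₀
              rw [← Literature.NumberTheory.EllipticCurves.AddSubgroup.torsionBy.coe_smul,
                hno a₀ ha₀X]
            · change g • (b₁ : geomPoints W) = b₁
              rw [← Literature.NumberTheory.EllipticCurves.AddSubgroup.torsionBy.coe_smul, hgb]
          have hx := hle x.2
          exact Subtype.ext (by
            rw [Literature.NumberTheory.EllipticCurves.AddSubgroup.torsionBy.coe_smul]; exact hx)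
        have ha0 : a ≠ 0 := fun h ↦ hga (by rw [h, smul_zero])
        obtain ⟨xa, ya, ha, hΨa, hxa, -⟩ := hzest a haX ha0
        obtain ⟨x₃, y₃, h₃, hsum, -, hx₃⟩ :=
          TateForm.sub_X_of_branch₀_of_one_lt hT hb₁ ha hxP1 hmidP hyb hxa
        refine ⟨b₁ + a, x₃, y₃, h₃, by rw [map_add, hΨb₁, hΨa, hsum], hx₃, ?_⟩
        rw [smul_add, hgb]
        exact fun h ↦ hga (add_left_cancel h)
      · exact ⟨b₁, xP, yb, hb₁, hΨb₁, rfl, hgb⟩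
    -- third: normalise the branch of `b₀` (negate if necessary)
    have hxc1 : w xc < 1 := hxc ▸ hxP1
    have hmidc : w ((tateFormOfJ jv).baseChange (AlgebraicClosure (v.adicCompletion K))).a₆ <
        w xc ^ 2 := hxc ▸ hmidP
    obtain ⟨b, yB, hB, hΨb, hyB, hgb⟩ : ∃ (b : geomTorsion W (p : ℤ))
        (yB : AlgebraicClosure (v.adicCompletion K))
        (hB : ((tateFormOfJ jv).baseChange
          (AlgebraicClosure (v.adicCompletion K))).toAffine.Nonsingular xc yB),
        Ψ' b = .some xc yB hB ∧ w yB < w xc ∧ g • b ≠ b := by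
      rcases TateForm.branch hT hc.1 hxc1 hmidc with hb | hb
      · exact ⟨b₀, yc, hc, hΨb₀, hb.1, hgb₀⟩
      · refine ⟨-b₀, _, (Affine.nonsingular_neg ..).mpr hc, by rw [map_neg, hΨb₀]; rfl, ?_, ?_⟩
        · rw [hT.negY, show -yc - xc = -(yc + xc) by ring, Valuation.map_neg]
          exact hb.1
        · rw [smul_neg]
          exact fun h ↦ hgb₀ (neg_injective h)
    /- Step 7: `τ x_b = x(Ψ b + D)`, `D = Ψ(τ b - b) ∈ T₁ ∖ O`, so
       `|τ x_b - x_b| = |x_b| |z(D)|`. -/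
    set δ : geomTorsion W (p : ℤ) := g • b - b with hδdef
    have hδX : δ ∈ X := hquotX τ hτ b
    have hδ0 : δ ≠ 0 := sub_ne_zero.mpr hgb
    obtain ⟨xd, yd, hd, hΨδ, hxd, hZest⟩ := hzest δ hδX hδ0
    obtain ⟨x₃, y₃, h₃, hsum, hsub, -⟩ :=
      TateForm.sub_X_of_branch₀_of_one_lt hT hB hd hxc1 hmidc hyB hxd
    have hgb_eq : Ψ' (g • b) = .some x₃ y₃ h₃ := by
      rw [show g • b = b + δ by rw [hδdef]; abel, map_add, hΨb, hΨδ, hsum]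
    have hσx : σE xc = x₃ := by
      have h1 := hΨg b
      rw [hgb_eq, hΨb, Affine.Point.map_some] at h1
      exact (((Affine.Point.some.injEq _ _ _ _ _ _).mp h1).1).symm
    have hest : w (σE xc - xc) = w xc * w (-xd / yd) := by rw [hσx]; exact hsub
    /- Step 8: the unit `ξ = x_b / p^{n/p}` (`|x_b| = |a₆|^{1/p} = |p|^{n/p}`,
       `n = ord_v Δ_min`). -/
    obtain ⟨m, hm⟩ := hdvd
    have hxcm : w xc = w (p : AlgebraicClosure (v.adicCompletion K)) ^ m := by
      have h1 : w xc ^ p = (w (p : AlgebraicClosure (v.adicCompletion K)) ^ m) ^ p := by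
        rw [hxc, hlev, ha₆v, hm, pow_mul']
      exact (pow_left_inj₀ zero_le zero_le hp0).mp h1
    set cL : AlgebraicClosure (v.adicCompletion K) :=
      (p : AlgebraicClosure (v.adicCompletion K)) ^ m with hcL
    have hcL0 : cL ≠ 0 := pow_ne_zero _ hpL
    have hwcL : w cL = w xc := by rw [hcL, Valuation.map_pow, hxcm]
    have hσcL : σE cL = cL := by rw [hcL, map_pow, map_natCast]
    refine ⟨xc / cL, ?_, ?_, ?_⟩
    · -- fixed by `ker ρ̄|Γ_{K_v}`
      intro σ hσ
      have hx := hfixx σ hσ b hΨb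
      change (absoluteGaloisGroup.toAlgEquiv (v.adicCompletion K) σ) (xc / cL) = xc / cL
      change (absoluteGaloisGroup.toAlgEquiv (v.adicCompletion K) σ) xc = xc at hx
      rw [map_div₀, hx, hcL, map_pow, map_natCast]
    · -- a unit
      have hxc0 : w xc ≠ 0 := hxP0.ne' ∘ (hxc ▸ ·)
      rw [← spectralValuation_le_one_iff_algNorm_le_one hw, map_div₀, hwcL, div_self hxc0]
    · -- `|p| ≤ |τ ξ - ξ|^{p-1} = |z(D)|^{p-1}`
      rw [map_natCast, ← algNorm_pow, ← spectralValuation_le_iff_algNorm_le hw, Valuation.map_pow,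
        ← hσE]
      have hdiff : σE (xc / cL) - xc / cL = (σE xc - xc) / cL := by
        rw [map_div₀, hσcL, sub_div]
      have hxc0 : w xc ≠ 0 := hxP0.ne' ∘ (hxc ▸ ·)
      have hval : w ((σE xc - xc) / cL) = w (-xd / yd) := by
        rw [map_div₀, hest, hwcL, mul_comm, mul_div_assoc, div_self hxc0, mul_one]
      rw [hdiff, hval]
      exact hZest

end WeierstrassCurve
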